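import Literature.Topology.FourManifolds.LefschetzHandlebody
import HarnessLib

/-!
# The base page misses the attaching circles of a Lefschetz link (Kas' engine, input E′)
(sub-goal `stub_Kas_page_subset_seamOff` of stub `stub_modelsOn_counts`, line `modp-braid-orbits`,
reshape r9, crux `ConvexBisection.AcyclicBisectionExists`, item stmt-SmoothPoincare4-10508)

In Kas' surgery description of `∂X(F; l)` (design `Kas_Design.lean`, wave 3 W3-1) the first homology of
the seam of the base off the attaching circles, `∂ Base g ∖ ⋃ᵢ Kᵢ`, is generated by a BASE PAGE and
the meridians.  The base page is the page of direction `1` (angle `0`): this file PROVES that it lies in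
the boundary of the base and misses every attaching circle of a Lefschetz link — the `i`-th circle lies
in the page of direction `pageDir n i = e^{−2πi(i+½)/n}` (`IsLefschetzLink.mem_page`), which is never
`1` (`pageDir_ne_one`: `2i + 1` is odd), and distinct pages are disjoint (`disjoint_page`).

Nothing is asserted; no `sorry`.
-/

noncomputable section

-- the prescribed namespace `Summit.<P>.<Sub>.…` duplicates `SmoothPoincare4` (P = Sub)
set_option linter.dupNamespace false

open scoped Manifold ContDiff Topology Real
open Set Function
open Literature.Topology.FourManifolds Literature.Topology.FourManifolds.LefschetzBase
  Literature.Topology.FourManifolds.HandleAttachingMap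

namespace Summit.SmoothPoincare4.SmoothPoincare4.Theorems.AcyclicBisectionExists.ModpBraidOrbits

/-- **No letter sits at angle `0`**: `pageDir n i = e^{−2πi(i+½)/n} ≠ 1` for `i < n`, since
`e^{iy} = 1` forces `y ∈ 2πℤ`, i.e. `2i + 1 = −2kn`, impossible by parity. [folklore] -/
theorem pageDir_ne_one {n i : ℕ} (hi : i < n) : pageDir n i ≠ 1 := by
  intro h
  rw [pageDir, Complex.exp_eq_one_iff] at h
  obtain ⟨k, hk⟩ := h
  have him := congrArg Complex.im hk
  simp only [Complex.mul_im, Complex.ofReal_re, Complex.ofReal_im, Complex.I_re, Complex.I_im,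
    mul_zero, mul_one, zero_add, Complex.mul_re, Complex.intCast_re, Complex.intCast_im,
    Complex.re_ofNat, Complex.im_ofNat, zero_mul, sub_zero] at him
  -- `him : -(2 * π * (i + 1/2) / n) = k * (2 * π)` up to normal form; clear denominators
  have hn : (0 : ℝ) < n := by exact_mod_cast lt_of_le_of_lt (Nat.zero_le i) hi
  have hpi : (0 : ℝ) < π := Real.pi_pos
  have key : (2 * (i : ℝ) + 1) = -(2 * (k : ℝ) * n) := by
    field_simp at him
    nlinarith [him, hpi, hn, mul_pos hpi hn]
  have hz : (2 * (i : ℤ) + 1) = -(2 * k * n) := by exact_mod_cast key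
  have hdvd : (2 : ℤ) ∣ 2 * (i : ℤ) + 1 := by rw [hz]; exact ⟨-(k * n), by ring⟩
  omega

/-- **The base page lies in the seam of the base off the attaching circles**: for a Lefschetz link
`h` realising `l`, `page g 1 ⊆ ∂ Base g ∩ (Base g ∖ ⋃ᵢ Kᵢ)` — pages lie in the boundary, the `i`-th
attaching circle `Kᵢ = (h i).core` lies in the page of direction `pageDir n i ≠ 1`, and distinct pages
are disjoint. [folklore] -/
theorem page_one_subset_boundary_inter_coresComplement {g : ℕ} {l : List ((Fin g ⊕ Fin g → ℤ) × Bool)}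
    {h : Fin l.length → HandleAttachingMap 3 2 (Base g)} (hl : IsLefschetzLink g l h) :
    page g 1 ⊆ (𝓡∂ 4).boundary (Base g) ∩ (coresComplement h : Set (Base g)) := by
  intro q hq
  refine ⟨page_subset_boundary g (by simp) hq, ?_⟩
  rw [SetLike.mem_coe, mem_coresComplement]
  intro i hi
  rw [← (h i).range_attachingCircle] at hi
  have hmem : q ∈ page g (pageDir l.length i) := hl.mem_page_dir i hi
  exact Set.disjoint_left.1 (disjoint_page g (pageDir_ne_one i.2).symm) hq hmem

/-- **Sub-goal `stub_Kas_page_subset_seamOff` of stub `stub_modelsOn_counts`** (line `modp-braid-orbits`,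
r9): input (E′) of Kas' engine — the base page `page g 1` lies in the boundary of the base and misses
every attaching circle of a Lefschetz link realising `l`. [folklore] -/
theorem stub_Kas_page_subset_seamOff :
    ∀ (g : ℕ) (l : List ((Fin g ⊕ Fin g → ℤ) × Bool))
      (h : Fin l.length → Literature.Topology.FourManifolds.HandleAttachingMap 3 2
        (Literature.Topology.FourManifolds.LefschetzBase.Base g)),
      Literature.Topology.FourManifolds.LefschetzBase.IsLefschetzLink g l h →
      Literature.Topology.FourManifolds.LefschetzBase.page g 1 ⊆
        (𝓡∂ 4).boundary (Literature.Topology.FourManifolds.LefschetzBase.Base g) ∩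
          (Literature.Topology.FourManifolds.HandleAttachingMap.coresComplement h :
            Set (Literature.Topology.FourManifolds.LefschetzBase.Base g)) :=
  fun _ _ _ hl => page_one_subset_boundary_inter_coresComplement hl

end Summit.SmoothPoincare4.SmoothPoincare4.Theorems.AcyclicBisectionExists.ModpBraidOrbits

end
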